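import Summits.CriticalPhenomena.PercolationContinuityZ3.Theorems.PercNearOneGluingNoHeavyLowerTailSahiGridPatternTwoLayerTop

/-!
# `NoHeavyLowerTail` (crux stmt-CriticalPhenomena-4575), Sahi programme: **THE STEP-TRANSFER IDENTITY — top-slice dominance on the
# upper-step clothing implies bottom-slice dominance on the lower-step clothing, in every dimension**

Support file (seat `prim-ineq-gen-4`, generation 12; `--supports stmt-CriticalPhenomena-4575`).  Pure proofs, no definitions, no `sorry`,
standard axioms.  Vocabulary of `…SahiGridPattern{,Tensor,SliceForm,Harris,TwoLayerTop}` (`Pd`, `sStarD`, `ind`, `TotDist`, `thirdPt`,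
`sStarD_counting`, `block_eq`).

THE MATHEMATICS.  A triple of up-sets of the cube `{0,1}^m` read along one axis `e` has, at every profile of the other axes, a comb line
`(c₀,c₁,c₂,c₃)` (three-copy fibre sums of Sahi's `E₃` with `j` copies up at `e`).  In the `[3]`-pattern model of the tree (`sStarD`) the SAME
pair (bottom sections `β = (A⁰,B⁰,C⁰)` ⊆ top sections `τ = (A¹,B¹,C¹)`, up-sets of `[3]^n`) has two clothings as up-sets of `[3]^{n+1}`:
the UPPER-STEP triple `υ` (slices `X₀ = X⁰`, `X₁ = X₂ = X¹`; `sStarD υ = 2^{n+1}c₂`) and the LOWER-STEP triple `λ` (slices `X₀ = X₁ = X⁰`,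
`X₂ = X¹`; `sStarD λ = 2^{n+1}c₁`), while `sStarD β = 2^n c₀`, `sStarD τ = 2^n c₃`.  THEOREM (`sStarD_lowerStep_sub_upperStep`, every `n`):
  `[sStarD λ − 2·sStarD β] − [sStarD υ − 2·sStarD τ] = 2 · #{Latin (x,y,z) : x ∈ A¹∖A⁰, y ∈ B¹∖B⁰, z ∈ C¹∖C⁰} ≥ 0`,
i.e. in comb language `(c₁ − c₀) − (c₂ − c₃) = a₃ =` the pure-increment Latin count (the third Bernstein difference of `E₃` along `e`).
COROLLARY (`two_mul_sStarD_bot_le_lowerStep_of_upperStep`): factor-2 TOP-slice dominance for the upper-step clothing (`2·sStarD τ ≤ sStarD υ`,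
the cube conjecture COMB-M⁺ `c₂ ≥ c₃`) implies factor-2 BOTTOM-slice dominance for the lower-step clothing (`2·sStarD β ≤ sStarD λ`, COMB-M⁻
`c₁ ≥ c₀`): the graded cube induction for Kahn's conjecture needs only COMB-M⁺ (memo
`run/shared/lean/prim/prim-ineq-gen-4/FINDING-STEP-TRANSFER-g12.md`).  Proof: expand both clothings and the two slice functionals into the
`27 + 27` level blocks (`block_eq`) and the counting form (`sStarD_counting`); everything cancels except the trilinear increment term. [this work]
-/

namespace Summit.CriticalPhenomena.PercolationContinuityZ3.Theorems.SahiGridPattern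

open Finset SahiGrid3
open scoped BigOperators

variable {m n : ℕ}

/-! ### Per-axis counts on all level triples (bookkeeping, `decide`) -/

/-- `c1 0 0 0` (bookkeeping). [this work] -/
private theorem stepVal_c1_000 : c1 (0:Fin 3) 0 0 = 2 := by decide
/-- `c1 0 0 1` (bookkeeping). [this work] -/
private theorem stepVal_c1_001 : c1 (0:Fin 3) 0 1 = 0 := by decide
/-- `c1 0 0 2` (bookkeeping). [this work] -/
private theorem stepVal_c1_002 : c1 (0:Fin 3) 0 2 = 0 := by decide
/-- `c1 0 1 0` (bookkeeping). [this work] -/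
private theorem stepVal_c1_010 : c1 (0:Fin 3) 1 0 = 0 := by decide
/-- `c1 0 1 1` (bookkeeping). [this work] -/
private theorem stepVal_c1_011 : c1 (0:Fin 3) 1 1 = 0 := by decide
/-- `c1 0 1 2` (bookkeeping). [this work] -/
private theorem stepVal_c1_012 : c1 (0:Fin 3) 1 2 = 0 := by decide
/-- `c1 0 2 0` (bookkeeping). [this work] -/
private theorem stepVal_c1_020 : c1 (0:Fin 3) 2 0 = 0 := by decide
/-- `c1 0 2 1` (bookkeeping). [this work] -/
private theorem stepVal_c1_021 : c1 (0:Fin 3) 2 1 = 0 := by decide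
/-- `c1 0 2 2` (bookkeeping). [this work] -/
private theorem stepVal_c1_022 : c1 (0:Fin 3) 2 2 = 0 := by decide
/-- `c1 1 0 0` (bookkeeping). [this work] -/
private theorem stepVal_c1_100 : c1 (1:Fin 3) 0 0 = 0 := by decide
/-- `c1 1 0 1` (bookkeeping). [this work] -/
private theorem stepVal_c1_101 : c1 (1:Fin 3) 0 1 = 0 := by decide
/-- `c1 1 0 2` (bookkeeping). [this work] -/
private theorem stepVal_c1_102 : c1 (1:Fin 3) 0 2 = 0 := by decide
/-- `c1 1 1 0` (bookkeeping). [this work] -/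
private theorem stepVal_c1_110 : c1 (1:Fin 3) 1 0 = 0 := by decide
/-- `c1 1 1 1` (bookkeeping). [this work] -/
private theorem stepVal_c1_111 : c1 (1:Fin 3) 1 1 = 2 := by decide
/-- `c1 1 1 2` (bookkeeping). [this work] -/
private theorem stepVal_c1_112 : c1 (1:Fin 3) 1 2 = 0 := by decide
/-- `c1 1 2 0` (bookkeeping). [this work] -/
private theorem stepVal_c1_120 : c1 (1:Fin 3) 2 0 = 0 := by decide
/-- `c1 1 2 1` (bookkeeping). [this work] -/
private theorem stepVal_c1_121 : c1 (1:Fin 3) 2 1 = 0 := by decide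
/-- `c1 1 2 2` (bookkeeping). [this work] -/
private theorem stepVal_c1_122 : c1 (1:Fin 3) 2 2 = 0 := by decide
/-- `c1 2 0 0` (bookkeeping). [this work] -/
private theorem stepVal_c1_200 : c1 (2:Fin 3) 0 0 = 0 := by decide
/-- `c1 2 0 1` (bookkeeping). [this work] -/
private theorem stepVal_c1_201 : c1 (2:Fin 3) 0 1 = 0 := by decide
/-- `c1 2 0 2` (bookkeeping). [this work] -/
private theorem stepVal_c1_202 : c1 (2:Fin 3) 0 2 = 0 := by decide
/-- `c1 2 1 0` (bookkeeping). [this work] -/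
private theorem stepVal_c1_210 : c1 (2:Fin 3) 1 0 = 0 := by decide
/-- `c1 2 1 1` (bookkeeping). [this work] -/
private theorem stepVal_c1_211 : c1 (2:Fin 3) 1 1 = 0 := by decide
/-- `c1 2 1 2` (bookkeeping). [this work] -/
private theorem stepVal_c1_212 : c1 (2:Fin 3) 1 2 = 0 := by decide
/-- `c1 2 2 0` (bookkeeping). [this work] -/
private theorem stepVal_c1_220 : c1 (2:Fin 3) 2 0 = 0 := by decide
/-- `c1 2 2 1` (bookkeeping). [this work] -/
private theorem stepVal_c1_221 : c1 (2:Fin 3) 2 1 = 0 := by decide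
/-- `c1 2 2 2` (bookkeeping). [this work] -/
private theorem stepVal_c1_222 : c1 (2:Fin 3) 2 2 = 2 := by decide
/-- `c2 0 0 0` (bookkeeping). [this work] -/
private theorem stepVal_c2_000 : c2 (0:Fin 3) 0 0 = 0 := by decide
/-- `c2 0 0 1` (bookkeeping). [this work] -/
private theorem stepVal_c2_001 : c2 (0:Fin 3) 0 1 = 0 := by decide
/-- `c2 0 0 2` (bookkeeping). [this work] -/
private theorem stepVal_c2_002 : c2 (0:Fin 3) 0 2 = 0 := by decide
/-- `c2 0 1 0` (bookkeeping). [this work] -/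
private theorem stepVal_c2_010 : c2 (0:Fin 3) 1 0 = 0 := by decide
/-- `c2 0 1 1` (bookkeeping). [this work] -/
private theorem stepVal_c2_011 : c2 (0:Fin 3) 1 1 = 1 := by decide
/-- `c2 0 1 2` (bookkeeping). [this work] -/
private theorem stepVal_c2_012 : c2 (0:Fin 3) 1 2 = 0 := by decide
/-- `c2 0 2 0` (bookkeeping). [this work] -/
private theorem stepVal_c2_020 : c2 (0:Fin 3) 2 0 = 0 := by decide
/-- `c2 0 2 1` (bookkeeping). [this work] -/
private theorem stepVal_c2_021 : c2 (0:Fin 3) 2 1 = 0 := by decide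
/-- `c2 0 2 2` (bookkeeping). [this work] -/
private theorem stepVal_c2_022 : c2 (0:Fin 3) 2 2 = 1 := by decide
/-- `c2 1 0 0` (bookkeeping). [this work] -/
private theorem stepVal_c2_100 : c2 (1:Fin 3) 0 0 = 1 := by decide
/-- `c2 1 0 1` (bookkeeping). [this work] -/
private theorem stepVal_c2_101 : c2 (1:Fin 3) 0 1 = 0 := by decide
/-- `c2 1 0 2` (bookkeeping). [this work] -/
private theorem stepVal_c2_102 : c2 (1:Fin 3) 0 2 = 0 := by decide
/-- `c2 1 1 0` (bookkeeping). [this work] -/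
private theorem stepVal_c2_110 : c2 (1:Fin 3) 1 0 = 0 := by decide
/-- `c2 1 1 1` (bookkeeping). [this work] -/
private theorem stepVal_c2_111 : c2 (1:Fin 3) 1 1 = 0 := by decide
/-- `c2 1 1 2` (bookkeeping). [this work] -/
private theorem stepVal_c2_112 : c2 (1:Fin 3) 1 2 = 0 := by decide
/-- `c2 1 2 0` (bookkeeping). [this work] -/
private theorem stepVal_c2_120 : c2 (1:Fin 3) 2 0 = 0 := by decide
/-- `c2 1 2 1` (bookkeeping). [this work] -/
private theorem stepVal_c2_121 : c2 (1:Fin 3) 2 1 = 0 := by decide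
/-- `c2 1 2 2` (bookkeeping). [this work] -/
private theorem stepVal_c2_122 : c2 (1:Fin 3) 2 2 = 1 := by decide
/-- `c2 2 0 0` (bookkeeping). [this work] -/
private theorem stepVal_c2_200 : c2 (2:Fin 3) 0 0 = 1 := by decide
/-- `c2 2 0 1` (bookkeeping). [this work] -/
private theorem stepVal_c2_201 : c2 (2:Fin 3) 0 1 = 0 := by decide
/-- `c2 2 0 2` (bookkeeping). [this work] -/
private theorem stepVal_c2_202 : c2 (2:Fin 3) 0 2 = 0 := by decide
/-- `c2 2 1 0` (bookkeeping). [this work] -/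
private theorem stepVal_c2_210 : c2 (2:Fin 3) 1 0 = 0 := by decide
/-- `c2 2 1 1` (bookkeeping). [this work] -/
private theorem stepVal_c2_211 : c2 (2:Fin 3) 1 1 = 1 := by decide
/-- `c2 2 1 2` (bookkeeping). [this work] -/
private theorem stepVal_c2_212 : c2 (2:Fin 3) 1 2 = 0 := by decide
/-- `c2 2 2 0` (bookkeeping). [this work] -/
private theorem stepVal_c2_220 : c2 (2:Fin 3) 2 0 = 0 := by decide
/-- `c2 2 2 1` (bookkeeping). [this work] -/
private theorem stepVal_c2_221 : c2 (2:Fin 3) 2 1 = 0 := by decide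
/-- `c2 2 2 2` (bookkeeping). [this work] -/
private theorem stepVal_c2_222 : c2 (2:Fin 3) 2 2 = 0 := by decide
/-- `c3 0 0 0` (bookkeeping). [this work] -/
private theorem stepVal_c3_000 : c3 (0:Fin 3) 0 0 = 0 := by decide
/-- `c3 0 0 1` (bookkeeping). [this work] -/
private theorem stepVal_c3_001 : c3 (0:Fin 3) 0 1 = 0 := by decide
/-- `c3 0 0 2` (bookkeeping). [this work] -/
private theorem stepVal_c3_002 : c3 (0:Fin 3) 0 2 = 0 := by decide
/-- `c3 0 1 0` (bookkeeping). [this work] -/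
private theorem stepVal_c3_010 : c3 (0:Fin 3) 1 0 = 0 := by decide
/-- `c3 0 1 1` (bookkeeping). [this work] -/
private theorem stepVal_c3_011 : c3 (0:Fin 3) 1 1 = 0 := by decide
/-- `c3 0 1 2` (bookkeeping). [this work] -/
private theorem stepVal_c3_012 : c3 (0:Fin 3) 1 2 = 1 := by decide
/-- `c3 0 2 0` (bookkeeping). [this work] -/
private theorem stepVal_c3_020 : c3 (0:Fin 3) 2 0 = 0 := by decide
/-- `c3 0 2 1` (bookkeeping). [this work] -/
private theorem stepVal_c3_021 : c3 (0:Fin 3) 2 1 = 1 := by decide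
/-- `c3 0 2 2` (bookkeeping). [this work] -/
private theorem stepVal_c3_022 : c3 (0:Fin 3) 2 2 = 0 := by decide
/-- `c3 1 0 0` (bookkeeping). [this work] -/
private theorem stepVal_c3_100 : c3 (1:Fin 3) 0 0 = 0 := by decide
/-- `c3 1 0 1` (bookkeeping). [this work] -/
private theorem stepVal_c3_101 : c3 (1:Fin 3) 0 1 = 0 := by decide
/-- `c3 1 0 2` (bookkeeping). [this work] -/
private theorem stepVal_c3_102 : c3 (1:Fin 3) 0 2 = 1 := by decide
/-- `c3 1 1 0` (bookkeeping). [this work] -/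
private theorem stepVal_c3_110 : c3 (1:Fin 3) 1 0 = 0 := by decide
/-- `c3 1 1 1` (bookkeeping). [this work] -/
private theorem stepVal_c3_111 : c3 (1:Fin 3) 1 1 = 0 := by decide
/-- `c3 1 1 2` (bookkeeping). [this work] -/
private theorem stepVal_c3_112 : c3 (1:Fin 3) 1 2 = 0 := by decide
/-- `c3 1 2 0` (bookkeeping). [this work] -/
private theorem stepVal_c3_120 : c3 (1:Fin 3) 2 0 = 1 := by decide
/-- `c3 1 2 1` (bookkeeping). [this work] -/
private theorem stepVal_c3_121 : c3 (1:Fin 3) 2 1 = 0 := by decide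
/-- `c3 1 2 2` (bookkeeping). [this work] -/
private theorem stepVal_c3_122 : c3 (1:Fin 3) 2 2 = 0 := by decide
/-- `c3 2 0 0` (bookkeeping). [this work] -/
private theorem stepVal_c3_200 : c3 (2:Fin 3) 0 0 = 0 := by decide
/-- `c3 2 0 1` (bookkeeping). [this work] -/
private theorem stepVal_c3_201 : c3 (2:Fin 3) 0 1 = 1 := by decide
/-- `c3 2 0 2` (bookkeeping). [this work] -/
private theorem stepVal_c3_202 : c3 (2:Fin 3) 0 2 = 0 := by decide
/-- `c3 2 1 0` (bookkeeping). [this work] -/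
private theorem stepVal_c3_210 : c3 (2:Fin 3) 1 0 = 1 := by decide
/-- `c3 2 1 1` (bookkeeping). [this work] -/
private theorem stepVal_c3_211 : c3 (2:Fin 3) 1 1 = 0 := by decide
/-- `c3 2 1 2` (bookkeeping). [this work] -/
private theorem stepVal_c3_212 : c3 (2:Fin 3) 1 2 = 0 := by decide
/-- `c3 2 2 0` (bookkeeping). [this work] -/
private theorem stepVal_c3_220 : c3 (2:Fin 3) 2 0 = 0 := by decide
/-- `c3 2 2 1` (bookkeeping). [this work] -/
private theorem stepVal_c3_221 : c3 (2:Fin 3) 2 1 = 0 := by decide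
/-- `c3 2 2 2` (bookkeeping). [this work] -/
private theorem stepVal_c3_222 : c3 (2:Fin 3) 2 2 = 0 := by decide

/-! ### Expanding a product of three increments -/

/-- Trilinear expansion of `Σ_{q,r} (b₂−b₀)(q)(c₂−c₀)(r)(a₂−a₀)(t q r)·T(q,r)` into its eight corner sums. [this work] -/
theorem sum_incr3_expand (a0 a2 b0 b2 c0 c2 : Pd m → ℤ) (t : Pd m → Pd m → Pd m) (T : Pd m → Pd m → ℤ) :
    (∑ q, ∑ r, (b2 q - b0 q) * (c2 r - c0 r) * (a2 (t q r) - a0 (t q r)) * T q r) =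
      (∑ q, ∑ r, b2 q * c2 r * a2 (t q r) * T q r) - (∑ q, ∑ r, b2 q * c2 r * a0 (t q r) * T q r)
      - (∑ q, ∑ r, b2 q * c0 r * a2 (t q r) * T q r) + (∑ q, ∑ r, b2 q * c0 r * a0 (t q r) * T q r)
      - (∑ q, ∑ r, b0 q * c2 r * a2 (t q r) * T q r) + (∑ q, ∑ r, b0 q * c2 r * a0 (t q r) * T q r)
      + (∑ q, ∑ r, b0 q * c0 r * a2 (t q r) * T q r) - (∑ q, ∑ r, b0 q * c0 r * a0 (t q r) * T q r) := by
  simp only [← Finset.sum_sub_distrib, ← Finset.sum_add_distrib]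
  exact Finset.sum_congr rfl fun q _ => Finset.sum_congr rfl fun r _ => by ring

/-- A product of three nonnegative increments against the `δ̸`-indicator is nonnegative. [this work] -/
theorem sum_incr3_nonneg {a0 a2 b0 b2 c0 c2 : Pd m → ℤ} (ha : ∀ p, a0 p ≤ a2 p) (hb : ∀ p, b0 p ≤ b2 p) (hc : ∀ p, c0 p ≤ c2 p)
    (t : Pd m → Pd m → Pd m) :
    0 ≤ ∑ q, ∑ r, (b2 q - b0 q) * (c2 r - c0 r) * (a2 (t q r) - a0 (t q r)) * (if TotDist q r = true then (1:ℤ) else 0) := by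
  refine Finset.sum_nonneg fun q _ => Finset.sum_nonneg fun r _ => ?_
  have h1 : 0 ≤ b2 q - b0 q := by linarith [hb q]
  have h2 : 0 ≤ c2 r - c0 r := by linarith [hc r]
  have h3 : 0 ≤ a2 (t q r) - a0 (t q r) := by linarith [ha (t q r)]
  have h4 : (0:ℤ) ≤ (if TotDist q r = true then (1:ℤ) else 0) := by split_ifs <;> norm_num
  exact mul_nonneg (mul_nonneg (mul_nonneg h1 h2) h3) h4

/-! ### The step-transfer identity -/

/-- **STEP-TRANSFER IDENTITY** (every `n`).  Let `Au, Bu, Cu ⊆ [3]^{n+1}` be an UPPER-STEP triple along the last axis (levels `1` and `2`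
have the same slice) and `Al, Bl, Cl` the LOWER-STEP triple with the same bottom and top slices (levels `0` and `1` share the bottom slice of the
upper-step triple, level `2` its top slice).  With `X⁰ = {q : snoc q 0 ∈ Xu}`, `X¹ = {q : snoc q 2 ∈ Xu}`:
`(sStarD Al Bl Cl − 2·sStarD A⁰ B⁰ C⁰) − (sStarD Au Bu Cu − 2·sStarD A¹ B¹ C¹) = 2·Σ_{q δ̸ r} (1_{B¹}−1_{B⁰})(q)(1_{C¹}−1_{C⁰})(r)(1_{A¹}−1_{A⁰})(q̄r)`.
No up-set hypothesis is needed for the identity. [this work] -/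
theorem sStarD_lowerStep_sub_upperStep (Au Bu Cu Al Bl Cl : Finset (Pd (n + 1)))
    (hAu : ∀ q : Pd n, ind Au (Fin.snoc q 1 : Pd (n + 1)) = ind Au (Fin.snoc q 2 : Pd (n + 1)))
    (hBu : ∀ q : Pd n, ind Bu (Fin.snoc q 1 : Pd (n + 1)) = ind Bu (Fin.snoc q 2 : Pd (n + 1)))
    (hCu : ∀ q : Pd n, ind Cu (Fin.snoc q 1 : Pd (n + 1)) = ind Cu (Fin.snoc q 2 : Pd (n + 1)))
    (hAl0 : ∀ q : Pd n, ind Al (Fin.snoc q 0 : Pd (n + 1)) = ind Au (Fin.snoc q 0 : Pd (n + 1)))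
    (hAl1 : ∀ q : Pd n, ind Al (Fin.snoc q 1 : Pd (n + 1)) = ind Au (Fin.snoc q 0 : Pd (n + 1)))
    (hAl2 : ∀ q : Pd n, ind Al (Fin.snoc q 2 : Pd (n + 1)) = ind Au (Fin.snoc q 2 : Pd (n + 1)))
    (hBl0 : ∀ q : Pd n, ind Bl (Fin.snoc q 0 : Pd (n + 1)) = ind Bu (Fin.snoc q 0 : Pd (n + 1)))
    (hBl1 : ∀ q : Pd n, ind Bl (Fin.snoc q 1 : Pd (n + 1)) = ind Bu (Fin.snoc q 0 : Pd (n + 1)))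
    (hBl2 : ∀ q : Pd n, ind Bl (Fin.snoc q 2 : Pd (n + 1)) = ind Bu (Fin.snoc q 2 : Pd (n + 1)))
    (hCl0 : ∀ q : Pd n, ind Cl (Fin.snoc q 0 : Pd (n + 1)) = ind Cu (Fin.snoc q 0 : Pd (n + 1)))
    (hCl1 : ∀ q : Pd n, ind Cl (Fin.snoc q 1 : Pd (n + 1)) = ind Cu (Fin.snoc q 0 : Pd (n + 1)))
    (hCl2 : ∀ q : Pd n, ind Cl (Fin.snoc q 2 : Pd (n + 1)) = ind Cu (Fin.snoc q 2 : Pd (n + 1))) :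
    (sStarD Al Bl Cl
        - 2 * sStarD (univ.filter fun q : Pd n => (Fin.snoc q 0 : Pd (n + 1)) ∈ Au)
                     (univ.filter fun q : Pd n => (Fin.snoc q 0 : Pd (n + 1)) ∈ Bu)
                     (univ.filter fun q : Pd n => (Fin.snoc q 0 : Pd (n + 1)) ∈ Cu))
      - (sStarD Au Bu Cu
        - 2 * sStarD (univ.filter fun q : Pd n => (Fin.snoc q 2 : Pd (n + 1)) ∈ Au)
                     (univ.filter fun q : Pd n => (Fin.snoc q 2 : Pd (n + 1)) ∈ Bu)
                     (univ.filter fun q : Pd n => (Fin.snoc q 2 : Pd (n + 1)) ∈ Cu)) =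
      2 * ∑ q, ∑ r, (ind (univ.filter fun q : Pd n => (Fin.snoc q 2 : Pd (n + 1)) ∈ Bu) q
                        - ind (univ.filter fun q : Pd n => (Fin.snoc q 0 : Pd (n + 1)) ∈ Bu) q)
                    * (ind (univ.filter fun q : Pd n => (Fin.snoc q 2 : Pd (n + 1)) ∈ Cu) r
                        - ind (univ.filter fun q : Pd n => (Fin.snoc q 0 : Pd (n + 1)) ∈ Cu) r)
                    * (ind (univ.filter fun q : Pd n => (Fin.snoc q 2 : Pd (n + 1)) ∈ Au) (thirdPt q r)
                        - ind (univ.filter fun q : Pd n => (Fin.snoc q 0 : Pd (n + 1)) ∈ Au) (thirdPt q r))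
                    * (if TotDist q r = true then (1:ℤ) else 0) := by
  -- the slices
  set A0 : Finset (Pd n) := univ.filter fun q : Pd n => (Fin.snoc q 0 : Pd (n + 1)) ∈ Au with hA0def
  set B0 : Finset (Pd n) := univ.filter fun q : Pd n => (Fin.snoc q 0 : Pd (n + 1)) ∈ Bu with hB0def
  set C0 : Finset (Pd n) := univ.filter fun q : Pd n => (Fin.snoc q 0 : Pd (n + 1)) ∈ Cu with hC0def
  set A2 : Finset (Pd n) := univ.filter fun q : Pd n => (Fin.snoc q 2 : Pd (n + 1)) ∈ Au with hA2def
  set B2 : Finset (Pd n) := univ.filter fun q : Pd n => (Fin.snoc q 2 : Pd (n + 1)) ∈ Bu with hB2def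
  set C2 : Finset (Pd n) := univ.filter fun q : Pd n => (Fin.snoc q 2 : Pd (n + 1)) ∈ Cu with hC2def
  have iAu0 : ∀ p, ind Au (Fin.snoc p 0) = ind A0 p := fun p => by rw [hA0def, ind_filter_snoc]
  have iBu0 : ∀ p, ind Bu (Fin.snoc p 0) = ind B0 p := fun p => by rw [hB0def, ind_filter_snoc]
  have iCu0 : ∀ p, ind Cu (Fin.snoc p 0) = ind C0 p := fun p => by rw [hC0def, ind_filter_snoc]
  have iAu2 : ∀ p, ind Au (Fin.snoc p 2) = ind A2 p := fun p => by rw [hA2def, ind_filter_snoc]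
  have iBu2 : ∀ p, ind Bu (Fin.snoc p 2) = ind B2 p := fun p => by rw [hB2def, ind_filter_snoc]
  have iCu2 : ∀ p, ind Cu (Fin.snoc p 2) = ind C2 p := fun p => by rw [hC2def, ind_filter_snoc]
  have iAu1 : ∀ p, ind Au (Fin.snoc p 1) = ind A2 p := fun p => by rw [hAu p, iAu2]
  have iBu1 : ∀ p, ind Bu (Fin.snoc p 1) = ind B2 p := fun p => by rw [hBu p, iBu2]
  have iCu1 : ∀ p, ind Cu (Fin.snoc p 1) = ind C2 p := fun p => by rw [hCu p, iCu2]
  have iAl0 : ∀ p, ind Al (Fin.snoc p 0) = ind A0 p := fun p => by rw [hAl0 p, iAu0]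
  have iBl0 : ∀ p, ind Bl (Fin.snoc p 0) = ind B0 p := fun p => by rw [hBl0 p, iBu0]
  have iCl0 : ∀ p, ind Cl (Fin.snoc p 0) = ind C0 p := fun p => by rw [hCl0 p, iCu0]
  have iAl1 : ∀ p, ind Al (Fin.snoc p 1) = ind A0 p := fun p => by rw [hAl1 p, iAu0]
  have iBl1 : ∀ p, ind Bl (Fin.snoc p 1) = ind B0 p := fun p => by rw [hBl1 p, iBu0]
  have iCl1 : ∀ p, ind Cl (Fin.snoc p 1) = ind C0 p := fun p => by rw [hCl1 p, iCu0]
  have iAl2 : ∀ p, ind Al (Fin.snoc p 2) = ind A2 p := fun p => by rw [hAl2 p, iAu2]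
  have iBl2 : ∀ p, ind Bl (Fin.snoc p 2) = ind B2 p := fun p => by rw [hBl2 p, iBu2]
  have iCl2 : ∀ p, ind Cl (Fin.snoc p 2) = ind C2 p := fun p => by rw [hCl2 p, iCu2]
  -- expand everything into level blocks / counting forms
  rw [sStarD_eq_sum_ind Al Bl Cl, sStarD_eq_sum_ind Au Bu Cu, sStarD_counting A0 B0 C0, sStarD_counting A2 B2 C2]
  simp only [sum_snoc, Fin.sum_univ_three, iAl0, iAl1, iAl2, iBl0, iBl1, iBl2, iCl0, iCl1, iCl2,
    iAu0, iAu1, iAu2, iBu0, iBu1, iBu2, iCu0, iCu1, iCu2, Finset.sum_add_distrib]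
  simp only [block_eq]
  simp only [stepVal_c1_000, stepVal_c1_001, stepVal_c1_002, stepVal_c1_010, stepVal_c1_011, stepVal_c1_012, stepVal_c1_020, stepVal_c1_021, stepVal_c1_022, stepVal_c1_100, stepVal_c1_101, stepVal_c1_102, stepVal_c1_110, stepVal_c1_111, stepVal_c1_112, stepVal_c1_120, stepVal_c1_121, stepVal_c1_122, stepVal_c1_200, stepVal_c1_201, stepVal_c1_202, stepVal_c1_210, stepVal_c1_211, stepVal_c1_212, stepVal_c1_220, stepVal_c1_221, stepVal_c1_222, stepVal_c2_000, stepVal_c2_001, stepVal_c2_002, stepVal_c2_010, stepVal_c2_011, stepVal_c2_012, stepVal_c2_020, stepVal_c2_021, stepVal_c2_022, stepVal_c2_100, stepVal_c2_101, stepVal_c2_102, stepVal_c2_110, stepVal_c2_111, stepVal_c2_112, stepVal_c2_120, stepVal_c2_121, stepVal_c2_122, stepVal_c2_200, stepVal_c2_201, stepVal_c2_202, stepVal_c2_210, stepVal_c2_211, stepVal_c2_212, stepVal_c2_220, stepVal_c2_221, stepVal_c2_222, stepVal_c3_000, stepVal_c3_001, stepVal_c3_002, stepVal_c3_010, stepVal_c3_011,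 stepVal_c3_012, stepVal_c3_020, stepVal_c3_021, stepVal_c3_022, stepVal_c3_100, stepVal_c3_101, stepVal_c3_102, stepVal_c3_110, stepVal_c3_111, stepVal_c3_112, stepVal_c3_120, stepVal_c3_121, stepVal_c3_122, stepVal_c3_200, stepVal_c3_201, stepVal_c3_202, stepVal_c3_210, stepVal_c3_211, stepVal_c3_212, stepVal_c3_220, stepVal_c3_221, stepVal_c3_222]
  rw [sum_incr3_expand (ind A0) (ind A2) (ind B0) (ind B2) (ind C0) (ind C2) thirdPt
    (fun q r => if TotDist q r = true then (1:ℤ) else 0)]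
  ring

/-- The increment term of the step-transfer identity is nonnegative for up-sets (slices are nested). [this work] -/
theorem sStarD_lowerStep_sub_upperStep_nonneg (Au Bu Cu Al Bl Cl : Finset (Pd (n + 1)))
    (hA : IsUpperSet (Au : Set (Pd (n + 1)))) (hB : IsUpperSet (Bu : Set (Pd (n + 1)))) (hC : IsUpperSet (Cu : Set (Pd (n + 1))))
    (hAu : ∀ q : Pd n, ind Au (Fin.snoc q 1 : Pd (n + 1)) = ind Au (Fin.snoc q 2 : Pd (n + 1)))
    (hBu : ∀ q : Pd n, ind Bu (Fin.snoc q 1 : Pd (n + 1)) = ind Bu (Fin.snoc q 2 : Pd (n + 1)))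
    (hCu : ∀ q : Pd n, ind Cu (Fin.snoc q 1 : Pd (n + 1)) = ind Cu (Fin.snoc q 2 : Pd (n + 1)))
    (hAl0 : ∀ q : Pd n, ind Al (Fin.snoc q 0 : Pd (n + 1)) = ind Au (Fin.snoc q 0 : Pd (n + 1)))
    (hAl1 : ∀ q : Pd n, ind Al (Fin.snoc q 1 : Pd (n + 1)) = ind Au (Fin.snoc q 0 : Pd (n + 1)))
    (hAl2 : ∀ q : Pd n, ind Al (Fin.snoc q 2 : Pd (n + 1)) = ind Au (Fin.snoc q 2 : Pd (n + 1)))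
    (hBl0 : ∀ q : Pd n, ind Bl (Fin.snoc q 0 : Pd (n + 1)) = ind Bu (Fin.snoc q 0 : Pd (n + 1)))
    (hBl1 : ∀ q : Pd n, ind Bl (Fin.snoc q 1 : Pd (n + 1)) = ind Bu (Fin.snoc q 0 : Pd (n + 1)))
    (hBl2 : ∀ q : Pd n, ind Bl (Fin.snoc q 2 : Pd (n + 1)) = ind Bu (Fin.snoc q 2 : Pd (n + 1)))
    (hCl0 : ∀ q : Pd n, ind Cl (Fin.snoc q 0 : Pd (n + 1)) = ind Cu (Fin.snoc q 0 : Pd (n + 1)))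
    (hCl1 : ∀ q : Pd n, ind Cl (Fin.snoc q 1 : Pd (n + 1)) = ind Cu (Fin.snoc q 0 : Pd (n + 1)))
    (hCl2 : ∀ q : Pd n, ind Cl (Fin.snoc q 2 : Pd (n + 1)) = ind Cu (Fin.snoc q 2 : Pd (n + 1))) :
    sStarD Au Bu Cu
        - 2 * sStarD (univ.filter fun q : Pd n => (Fin.snoc q 2 : Pd (n + 1)) ∈ Au)
                     (univ.filter fun q : Pd n => (Fin.snoc q 2 : Pd (n + 1)) ∈ Bu)
                     (univ.filter fun q : Pd n => (Fin.snoc q 2 : Pd (n + 1)) ∈ Cu)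
      ≤ sStarD Al Bl Cl
        - 2 * sStarD (univ.filter fun q : Pd n => (Fin.snoc q 0 : Pd (n + 1)) ∈ Au)
                     (univ.filter fun q : Pd n => (Fin.snoc q 0 : Pd (n + 1)) ∈ Bu)
                     (univ.filter fun q : Pd n => (Fin.snoc q 0 : Pd (n + 1)) ∈ Cu) := by
  have e := sStarD_lowerStep_sub_upperStep Au Bu Cu Al Bl Cl hAu hBu hCu hAl0 hAl1 hAl2 hBl0 hBl1 hBl2 hCl0 hCl1 hCl2
  have nA : ∀ p, ind (univ.filter fun q : Pd n => (Fin.snoc q 0 : Pd (n + 1)) ∈ Au) p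
      ≤ ind (univ.filter fun q : Pd n => (Fin.snoc q 2 : Pd (n + 1)) ∈ Au) p := fun p => by
    rw [ind_filter_snoc, ind_filter_snoc]; exact ind_snoc_mono hA p (by decide)
  have nB : ∀ p, ind (univ.filter fun q : Pd n => (Fin.snoc q 0 : Pd (n + 1)) ∈ Bu) p
      ≤ ind (univ.filter fun q : Pd n => (Fin.snoc q 2 : Pd (n + 1)) ∈ Bu) p := fun p => by
    rw [ind_filter_snoc, ind_filter_snoc]; exact ind_snoc_mono hB p (by decide)
  have nC : ∀ p, ind (univ.filter fun q : Pd n => (Fin.snoc q 0 : Pd (n + 1)) ∈ Cu) p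
      ≤ ind (univ.filter fun q : Pd n => (Fin.snoc q 2 : Pd (n + 1)) ∈ Cu) p := fun p => by
    rw [ind_filter_snoc, ind_filter_snoc]; exact ind_snoc_mono hC p (by decide)
  have h0 := sum_incr3_nonneg nA nB nC thirdPt
  linarith

/-- **COMB-M⁺ ⟹ COMB-M⁻, every dimension.**  If the upper-step triple satisfies factor-2 TOP-slice dominance
(`2·sStarD(top slices) ≤ sStarD Au Bu Cu`), then the lower-step triple with the same sections satisfies factor-2 BOTTOM-slice dominance
(`2·sStarD(bottom slices) ≤ sStarD Al Bl Cl`). [this work] -/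
theorem two_mul_sStarD_bot_le_lowerStep_of_upperStep (Au Bu Cu Al Bl Cl : Finset (Pd (n + 1)))
    (hA : IsUpperSet (Au : Set (Pd (n + 1)))) (hB : IsUpperSet (Bu : Set (Pd (n + 1)))) (hC : IsUpperSet (Cu : Set (Pd (n + 1))))
    (hAu : ∀ q : Pd n, ind Au (Fin.snoc q 1 : Pd (n + 1)) = ind Au (Fin.snoc q 2 : Pd (n + 1)))
    (hBu : ∀ q : Pd n, ind Bu (Fin.snoc q 1 : Pd (n + 1)) = ind Bu (Fin.snoc q 2 : Pd (n + 1)))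
    (hCu : ∀ q : Pd n, ind Cu (Fin.snoc q 1 : Pd (n + 1)) = ind Cu (Fin.snoc q 2 : Pd (n + 1)))
    (hAl0 : ∀ q : Pd n, ind Al (Fin.snoc q 0 : Pd (n + 1)) = ind Au (Fin.snoc q 0 : Pd (n + 1)))
    (hAl1 : ∀ q : Pd n, ind Al (Fin.snoc q 1 : Pd (n + 1)) = ind Au (Fin.snoc q 0 : Pd (n + 1)))
    (hAl2 : ∀ q : Pd n, ind Al (Fin.snoc q 2 : Pd (n + 1)) = ind Au (Fin.snoc q 2 : Pd (n + 1)))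
    (hBl0 : ∀ q : Pd n, ind Bl (Fin.snoc q 0 : Pd (n + 1)) = ind Bu (Fin.snoc q 0 : Pd (n + 1)))
    (hBl1 : ∀ q : Pd n, ind Bl (Fin.snoc q 1 : Pd (n + 1)) = ind Bu (Fin.snoc q 0 : Pd (n + 1)))
    (hBl2 : ∀ q : Pd n, ind Bl (Fin.snoc q 2 : Pd (n + 1)) = ind Bu (Fin.snoc q 2 : Pd (n + 1)))
    (hCl0 : ∀ q : Pd n, ind Cl (Fin.snoc q 0 : Pd (n + 1)) = ind Cu (Fin.snoc q 0 : Pd (n + 1)))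
    (hCl1 : ∀ q : Pd n, ind Cl (Fin.snoc q 1 : Pd (n + 1)) = ind Cu (Fin.snoc q 0 : Pd (n + 1)))
    (hCl2 : ∀ q : Pd n, ind Cl (Fin.snoc q 2 : Pd (n + 1)) = ind Cu (Fin.snoc q 2 : Pd (n + 1)))
    (hTop : 2 * sStarD (univ.filter fun q : Pd n => (Fin.snoc q 2 : Pd (n + 1)) ∈ Au)
                       (univ.filter fun q : Pd n => (Fin.snoc q 2 : Pd (n + 1)) ∈ Bu)
                       (univ.filter fun q : Pd n => (Fin.snoc q 2 : Pd (n + 1)) ∈ Cu) ≤ sStarD Au Bu Cu) :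
    2 * sStarD (univ.filter fun q : Pd n => (Fin.snoc q 0 : Pd (n + 1)) ∈ Au)
               (univ.filter fun q : Pd n => (Fin.snoc q 0 : Pd (n + 1)) ∈ Bu)
               (univ.filter fun q : Pd n => (Fin.snoc q 0 : Pd (n + 1)) ∈ Cu) ≤ sStarD Al Bl Cl := by
  have h := sStarD_lowerStep_sub_upperStep_nonneg Au Bu Cu Al Bl Cl hA hB hC hAu hBu hCu hAl0 hAl1 hAl2 hBl0 hBl1 hBl2 hCl0 hCl1 hCl2
  linarith

end Summit.CriticalPhenomena.PercolationContinuityZ3.Theorems.SahiGridPattern
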